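import Summits.AtomisticToContinuum.HydrodynamicLimit.Theses.UGibbsSRBRigidity

/-!
# `GibbsStatesURegularSlaved` (support stmt-AtomisticToContinuum-13992, route `UGibbsSRBRigidity`):
# negative lemma — the sanity statement is FALSE as soon as one equilibrium flow carries, at
# arbitrarily small activity, a translation-invariant Gibbs state whose contact-slaved plaques (D5,
# `Literature.Dynamics.Billiards.slavedUnstablePlaques`) are leaf-null almost surely

`GibbsStatesURegularSlaved` claims `∃ z₀ > 0, ∀ Φ equilibrium, ∀ 0 < z < z₀, ∀ β > 0`, every
translation-invariant hard-sphere Gibbs state `g` (`IsHardSphereGibbs 1 z β 0 g`) is u-regular for the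
functor `slavedUnstablePlaques 1 Φ`.

Here we record, sorry-free, the formal half of the refutation argued in the evidence file
`SyncAbsorption.md` attached to the item (prover seat, 2026-08-16):

* `eq_zero_of_isURegular_of_ae_leafNull` — for ANY plaque family, a law all of whose plaques are
  leaf-null almost surely is u-regular only if it is the zero measure (the u-regularity axiom applied to
  `s = univ`);
* `LeafNullSlavedPlaques` — the hypothesis `H` (a CONSTRUCTION the tree cannot perform: it needs
  Alexander's flow `InfiniteHardSphereFlow.nonempty`, an infinite-volume Gibbs state, and the almost-sure
  collision statistics of its backward orbits): some equilibrium flow `Φ` admits, for every `z₀ > 0`, a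
  translation-invariant Gibbs state `g` with `0 < z < z₀`, `0 < β`, whose D5 plaques are leaf-null `g`-a.s.;
* `GibbsStatesURegularSlaved_false_of_LeafNullSlavedPlaques : LeafNullSlavedPlaques → ¬ GibbsStatesURegularSlaved`.

WHY `H` IS EXPECTED TO HOLD for Alexander's flow and every dilute Gibbs state (evidence file, with
numerics): (1) SYNCHRONISATION — the convergence clause of `slavedUnstableSet` bounds the SUP phase-space
distance (positions AND velocities, `dist` on `ℝ³ × ℝ³`) by `e^{-rs}` at ALL real reversed times
`s ≥ S₀`; since velocities are piecewise constant with jumps `|⟨n, w⟩| = O(1)` at contacts, a window path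
can stay `e^{-rs}`-close to its record only if its late contact instants COINCIDE with the recorded ones
(machine-checked: `Theorems.SlavedSync.mem_collisionEvents_of_jump` in the companion helper file);
(2) ABSORPTION — at a contact with a fresh exterior particle the equal-mass law hands the window particle's
normal velocity error to the partner, which the definition never constrains again: the one-contact transfer
map has rank `5`, and the synchronised set through the recorded datum is, for almost every environment, a
countable bouquet of `k`-dimensional `C¹` pieces (`k` = number of window particles) inside the
`6k`-dimensional window data, hence `μH[3k]`-null: the plaques are leaf-null although not singletons.
This file does NOT refute the item unconditionally; it isolates the construction `H`.
-/

noncomputable section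

namespace Summit.AtomisticToContinuum.HydrodynamicLimit.Theorems.GibbsStatesURegularSlaved.Negative

open MeasureTheory Set Filter
open Literature.Analysis.FluidPDE Literature.Analysis.FunctionSpaces Literature.Dynamics.Billiards
open Summit.AtomisticToContinuum.HydrodynamicLimit.Theses.UGibbsSRBRigidity

/-- **Vacuity of u-regularity on leaf-null plaques** (any plaque family `L` on any measurable space):
if `L.leafMeasure x (L.plaque x) = 0` for `μ`-a.e. `x`, then `μ` is u-regular for `L` only if `μ = 0`
(take `s = univ` in `PlaqueFamily.IsURegular`). -/
theorem eq_zero_of_isURegular_of_ae_leafNull {α : Type*} [MeasurableSpace α] (L : PlaqueFamily α)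
    (μ : Measure α) (hnull : ∀ᵐ x ∂μ, L.leafMeasure x (L.plaque x) = 0) (h : L.IsURegular μ) :
    μ = 0 := by
  rw [← Measure.measure_univ_eq_zero]
  refine h univ MeasurableSet.univ ?_
  filter_upwards [hnull] with x hx
  rwa [univ_inter]

/-- A probability measure is not u-regular for a plaque family whose plaques are leaf-null almost
surely. -/
theorem not_isURegular_of_ae_leafNull {α : Type*} [MeasurableSpace α] (L : PlaqueFamily α)
    (μ : Measure α) [IsProbabilityMeasure μ] (hnull : ∀ᵐ x ∂μ, L.leafMeasure x (L.plaque x) = 0) :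
    ¬ L.IsURegular μ := fun h =>
  IsProbabilityMeasure.ne_zero μ (eq_zero_of_isURegular_of_ae_leafNull L μ hnull h)

/-- **The construction `H`** (hypothesis of the negative lemma; not performable in the tree, which holds
neither Alexander's flow nor an infinite-volume hard-sphere Gibbs state as objects): there is an
equilibrium infinite hard-sphere flow `Φ` (diameter `1`, `d = 3`) such that for every `z₀ > 0` some
translation-invariant Gibbs state `g` with activity `0 < z < z₀` and inverse temperature `β > 0` has
`g`-almost surely LEAF-NULL contact-slaved plaques:
`(slavedUnstablePlaques 1 Φ).leafMeasure ω ((slavedUnstablePlaques 1 Φ).plaque ω) = 0`.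
Expected to hold for Alexander's flow and EVERY dilute Gibbs state by synchronisation + absorption
(module docstring; evidence `SyncAbsorption.md` on stmt-AtomisticToContinuum-13992). -/
def LeafNullSlavedPlaques : Prop :=
  ∃ Φ : InfiniteHardSphereFlow (Fin 3) 1, Φ.IsEquilibriumFlow ∧
    ∀ z₀ : ℝ, 0 < z₀ →
      ∃ (z β : ℝ) (g : Measure (PointConfig (EuclideanSpace ℝ (Fin 3) × EuclideanSpace ℝ (Fin 3)))),
        0 < z ∧ z < z₀ ∧ 0 < β ∧ IsHardSphereGibbs 1 z β 0 g ∧ IsTranslationInvariant g ∧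
          ∀ᵐ ω ∂g, (slavedUnstablePlaques 1 Φ).leafMeasure ω ((slavedUnstablePlaques 1 Φ).plaque ω) = 0

/-- **Negative lemma**: `LeafNullSlavedPlaques → ¬ GibbsStatesURegularSlaved`. Given the `z₀` of the
sanity statement, `H` supplies a dilute translation-invariant Gibbs state with a.s. leaf-null plaques;
the statement makes it u-regular, hence zero by `eq_zero_of_isURegular_of_ae_leafNull`, contradicting
`IsProbabilityMeasure` (part of `IsHardSphereGibbs`). -/
theorem GibbsStatesURegularSlaved_false_of_LeafNullSlavedPlaques :
    LeafNullSlavedPlaques → ¬ GibbsStatesURegularSlaved := by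
  rintro ⟨Φ, hΦ, hH⟩ ⟨z₀, hz₀, hS⟩
  obtain ⟨z, β, g, hz, hzz₀, hβ, hg, hti, hnull⟩ := hH z₀ hz₀
  haveI : IsProbabilityMeasure g := hg.1
  exact not_isURegular_of_ae_leafNull _ g hnull (hS Φ hΦ z β g hz hzz₀ hβ hg hti)

end Summit.AtomisticToContinuum.HydrodynamicLimit.Theorems.GibbsStatesURegularSlaved.Negative
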